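import Literature.AlgebraicGeometry.HodgeTheory.BettiUniverseTracePairing
import Literature.AlgebraicGeometry.HodgeTheory.FibrewiseDeckRelations
import Literature.AlgebraicGeometry.HodgeTheory.CyclicCoverReflectionMonodromy
import HarnessLib

/-!
# Route `Q8SymplecticPowers`, crux K1Q (stmt-HodgeConjecture-24190), stub S5 `stub_monodromyBireflectionQ`:
# the trace-pairing facts of the Betti-universe bridge, on S5's own carrier

Prover seat `hodge-nonav-20241-p1` (g22); helper `--supports stmt-HodgeConjecture-24190` (closes no registered
stub); item (C3) of the planner's brick map (p3 g37, 2026-08-29 14:57Z). S5 is typed on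
`H := bettiCohomology (fiberOver π s) 2 = H²(X_s(ℂ); ℚ)` with the bilinear form
`Qf := compr₂ (cup Xs 2 2) (tr hXs (2 + 2))` («`tr ∘ cup`», the LIGHT trace of `BettiUniverseAxioms`: the
coordinate along a chosen generator of the line `H⁴(X_s(ℂ); ℚ)`), whereas prover-Ax's recognition theorem
`Q8BireflectionRecognitionHomological.exists_bireflection_datum_of_homological_datum_poincare` takes an ABSTRACT
symmetric non-degenerate `Q` for which the deck maps and the monodromy are isometries, plus the
disjoint-carrier orthogonality «`Q a b = 0` when `D a ∈ W₁`, `D b ∈ W₂`» (`D` = Poincaré duality of the rational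
complex orientation `complexOrientationRat hXs`), which the geometry supplies in the currency of the CUP-PRODUCT
PAIRING `⟨a ∪ b, [X_s(ℂ)]⟩` (`cupPairing`, `DisjointCarriersCupPairing`). This file records, for every smooth
projective SURFACE `X`, the four facts that let `Q := Qf` enter there:

* `tr_cup_symm` — `Qf` is symmetric (`cup_comm_of_even`);
* `nondegenerate_tr_cup_two` — `Qf` is non-degenerate (Poincaré duality, the tree's `nondegenerate_tr_cup`);
* `exists_tr_cup_eq_mul_cupPairing` — **`Qf = c • ⟨· ∪ ·, [X(ℂ)]⟩` with `c ≠ 0`**: `tr hX 4` and the Kronecker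
  pairing against the fundamental class `[X(ℂ)]` of `complexOrientationRat hX` are two non-zero linear functionals
  on the LINE `H⁴(X(ℂ); ℚ)` (`finrank_bettiCohomology_top`; the second is non-zero because `H₄ = ℚ·[X(ℂ)]`,
  Hatcher Thm. 3.26 `exists_eq_smul_fundamentalClass_of_connectedSpace`, and the Kronecker map is injective over a
  field, Hatcher Thm. 3.2 `kroneckerPairing_injective_of_field`), hence proportional — so every orthogonality ∕
  isometry statement transfers between the two currencies (`tr_cup_eq_zero_iff_cupPairing_eq_zero`);
* `tr_cup_pull_fiberOverEnd_of_comp_four` — for an endomorphism `σ` of a family `π : 𝒳 → S` over `S` with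
  `σ⁴ = 𝟙` (the deck maps `τ`, `j` of the registered family: `j⁴ = τ⁴ = 𝟙`), the fibre map `σ_s^* = pull
  (fiberOverEnd π σ hσ s) 2` is a `Qf`-isometry (the tree's `tr_cup_pull_pull_of_comp_eq_id` with the inverse
  `σ_s³`; no `p_g > 0` hypothesis, unlike `Q8SymplecticPowersDeckIsometry`).

HONEST FRAMING: bookkeeping only; S5 ∕ K1Q ∕ HC NOT proved.
-/

noncomputable section

set_option linter.dupNamespace false

namespace Summit.HodgeConjecture.HodgeConjecture.Theorems.Q8SymplecticPowersTracePairingBridge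

open CategoryTheory CategoryTheory.Limits Module
open Literature.AlgebraicTopology.SingularHomology
open Literature.AlgebraicGeometry.Motives Literature.AlgebraicGeometry.HodgeTheory
open Literature.AlgebraicGeometry.HodgeTheory.BettiUniverse

/-! ### §1 Two non-zero functionals on a line are proportional -/

/-- Two linear functionals on a one-dimensional space, both non-zero, are proportional with a non-zero
factor. [folklore] -/
theorem exists_eq_smul_of_finrank_eq_one {K V : Type*} [Field K] [AddCommGroup V] [Module K V]
    (h1 : finrank K V = 1) {f g : V →ₗ[K] K} (hf : f ≠ 0) (hg : g ≠ 0) :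
    ∃ c : K, c ≠ 0 ∧ ∀ v, f v = c * g v := by
  haveI : FiniteDimensional K V := Module.finite_of_finrank_eq_succ h1
  obtain ⟨v, hv⟩ := DFunLike.ne_iff.1 hg
  rw [LinearMap.zero_apply] at hv
  have hv0 : v ≠ 0 := fun h ↦ hv (by rw [h, map_zero])
  have hfv : f v ≠ 0 := by
    intro hfv
    apply hf
    refine LinearMap.ext fun w ↦ ?_
    obtain ⟨a, rfl⟩ := (finrank_eq_one_iff_of_nonzero' v hv0).1 h1 w
    rw [map_smul, hfv, smul_zero, LinearMap.zero_apply]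
  refine ⟨f v / g v, div_ne_zero hfv hv, fun w ↦ ?_⟩
  obtain ⟨a, rfl⟩ := (finrank_eq_one_iff_of_nonzero' v hv0).1 h1 w
  rw [map_smul, map_smul, smul_eq_mul, smul_eq_mul]
  field_simp

/-! ### §2 The trace pairing of a smooth projective surface -/

section Surface

variable {X : SchemeOver ℂ}

/-- **`Qf` is symmetric**: `tr(x ∪ y) = tr(y ∪ x)` on `H²(X(ℂ); ℚ)` (the cup product of even-degree classes
is commutative). [cite: HatcherAT2002, §3.2 Thm. 3.11] -/
theorem tr_cup_symm (hX : IsSmoothProjective 2 X) (x y : bettiCohomology X 2) :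
    tr hX (2 + 2) (cup X 2 2 x y) = tr hX (2 + 2) (cup X 2 2 y x) := by
  rw [cup_comm_of_even (by decide)]

/-- **`Qf` is non-degenerate** (Poincaré duality over `ℚ` for the closed oriented 4-manifold `X(ℂ)`; the
tree's `nondegenerate_tr_cup` at `n = 2`). [cite: HatcherAT2002, §3.3 Prop. 3.38] -/
theorem nondegenerate_tr_cup_two (hX : IsSmoothProjective 2 X) :
    (LinearMap.compr₂ (cup X 2 2) (tr hX (2 + 2))).Nondegenerate :=
  nondegenerate_tr_cup hX

/-- **The Kronecker pairing against the fundamental class is a non-zero functional on `H⁴(X(ℂ); ℚ)`**: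
`H₄(X(ℂ); ℚ) = ℚ · [X(ℂ)]` (Hatcher Thm. 3.26) and the Kronecker map `H⁴ → Hom(H₄, ℚ)` is injective
(Hatcher Thm. 3.2), while `H⁴ ≠ 0`. [cite: HatcherAT2002, §3.3 Thm. 3.26 and §3.1 Thm. 3.2] -/
theorem kroneckerPairing_fundamentalClass_ne_zero (hX : IsSmoothProjective 2 X) :
    (kroneckerPairing ℚ ℚ (ComplexPoints X) (2 * 2)).flip (complexOrientationRat hX).fundamentalClass ≠ 0 := by
  letI := hX.chartedSpace
  haveI := ComplexPoints.compactSpace_of_isSmoothProjective hX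
  haveI := ComplexPoints.t2Space_of_isSmoothProjective hX
  haveI := connectedSpace_complexPoints hX
  haveI : FiniteDimensional ℚ (bettiCohomology X (2 * 2)) := finite hX (2 * 2)
  -- a non-zero class `z ∈ H⁴`
  have h1 := finrank_bettiCohomology_top hX
  obtain ⟨z, hz⟩ : ∃ z : bettiCohomology X (2 * 2), z ≠ 0 := by
    by_contra h
    push Not at h
    have : finrank ℚ (bettiCohomology X (2 * 2)) = 0 := finrank_zero_iff_forall_zero.2 h
    omega
  -- its Kronecker functional is non-zero, hence non-zero on the generator `[X(ℂ)]` of `H₄`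
  intro hκ
  have hinj := kroneckerPairing_injective_of_field ℚ (ComplexPoints X) (2 * 2)
  have hzκ : kroneckerPairing ℚ ℚ (ComplexPoints X) (2 * 2) z ≠ 0 := by
    intro h0
    exact hz (hinj (by rw [h0, map_zero]))
  obtain ⟨c, hc⟩ := DFunLike.ne_iff.1 hzκ
  obtain ⟨a, rfl⟩ := exists_eq_smul_fundamentalClass_of_connectedSpace (complexOrientationRat hX) c
  rw [map_smul, LinearMap.zero_apply, smul_eq_mul] at hc
  have h0 : kroneckerPairing ℚ ℚ (ComplexPoints X) (2 * 2) z (complexOrientationRat hX).fundamentalClass = 0 := by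
    have := LinearMap.congr_fun hκ z
    rwa [LinearMap.flip_apply, LinearMap.zero_apply] at this
  exact hc (by rw [h0, mul_zero])

/-- Shorthand used below: the top degree written `2 + 2` is the top degree `2 * 2`. [folklore] -/
private theorem two_add_two : (2 : ℕ) + 2 = 2 * 2 := rfl

/-- **`Qf = c • ⟨· ∪ ·, [X(ℂ)]⟩` with `c ≠ 0`**: the light trace pairing `tr(x ∪ y)` of a smooth projective
surface is a NON-ZERO rational multiple of the cup-product pairing of the rational complex orientation
(`cupPairing (complexOrientationRat hX)`: `(x, y) ↦ ⟨x ∪ y, [X(ℂ)]⟩`) — two non-zero functionals on the line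
`H⁴(X(ℂ); ℚ)` are proportional. [cite: HatcherAT2002, §3.3 Thm. 3.26 and Prop. 3.38]
[cite: VoisinHodgeI2002, §7.1.2] -/
theorem exists_tr_cup_eq_mul_cupPairing (hX : IsSmoothProjective 2 X) :
    ∃ c : ℚ, c ≠ 0 ∧ ∀ x y : bettiCohomology X 2,
      tr hX (2 + 2) (cup X 2 2 x y) = c * cupPairing (complexOrientationRat hX) two_add_two x y := by
  obtain ⟨c, hc, hprop⟩ := exists_eq_smul_of_finrank_eq_one (finrank_bettiCohomology_top hX)
    (tr_top_ne_zero hX) (kroneckerPairing_fundamentalClass_ne_zero hX)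
  refine ⟨c, hc, fun x y ↦ ?_⟩
  rw [cupPairing_apply]
  exact hprop (cup X 2 2 x y)

/-- **The two currencies have the same orthogonality**: `tr(x ∪ y) = 0 ↔ ⟨x ∪ y, [X(ℂ)]⟩ = 0` — so the
disjoint-carrier orthogonality of vanishing cycles (cup-pairing currency) is exactly the `Qf`-orthogonality
clause of S5. [cite: HatcherAT2002, §3.3 Thm. 3.26 and Prop. 3.38] -/
theorem tr_cup_eq_zero_iff_cupPairing_eq_zero (hX : IsSmoothProjective 2 X) (x y : bettiCohomology X 2) :
    tr hX (2 + 2) (cup X 2 2 x y) = 0 ↔ cupPairing (complexOrientationRat hX) two_add_two x y = 0 := by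
  obtain ⟨c, hc, hprop⟩ := exists_tr_cup_eq_mul_cupPairing hX
  rw [hprop x y, mul_eq_zero]
  exact ⟨fun h ↦ h.resolve_left hc, fun h ↦ Or.inr h⟩

end Surface

/-! ### §3 The fibrewise deck maps of order dividing four are `Qf`-isometries -/

section Family

variable {𝒳 S : SchemeOver ℂ} (π : 𝒳 ⟶ S)

/-- `σ⁴ = 𝟙 ⇒ σ_s ≫ σ_s³ = 𝟙` and `σ_s³ ≫ σ_s = 𝟙` for the fibre maps (functoriality of `fiberOverEnd`).
[cite: Fulton1998, §10.1] -/
theorem fiberOverEnd_comp_cube_eq_id {σ : 𝒳 ⟶ 𝒳} (hσ : σ ≫ π = π) (h4 : σ ≫ σ ≫ σ ≫ σ = 𝟙 𝒳)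
    (s : ComplexPoints S) :
    fiberOverEnd π σ hσ s ≫ fiberOverEnd π (σ ≫ σ ≫ σ) (by rw [Category.assoc, Category.assoc, hσ, hσ, hσ]) s =
        𝟙 (fiberOver π s) ∧
      fiberOverEnd π (σ ≫ σ ≫ σ) (by rw [Category.assoc, Category.assoc, hσ, hσ, hσ]) s ≫ fiberOverEnd π σ hσ s =
        𝟙 (fiberOver π s) := by
  have h3 : (σ ≫ σ ≫ σ) ≫ π = π := by rw [Category.assoc, Category.assoc, hσ, hσ, hσ]
  have h4' : (σ ≫ σ ≫ σ) ≫ σ = 𝟙 𝒳 := by simpa only [Category.assoc] using h4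
  constructor
  · rw [← fiberOverEnd_comp π σ (σ ≫ σ ≫ σ) hσ h3, fiberOverEnd_congr π h4 _ (Category.id_comp π), fiberOverEnd_id]
  · rw [← fiberOverEnd_comp π (σ ≫ σ ≫ σ) σ h3 hσ, fiberOverEnd_congr π h4' _ (Category.id_comp π), fiberOverEnd_id]

/-- **The fibre map of an endomorphism `σ` over the base with `σ⁴ = 𝟙` is a `Qf`-isometry** on `H²(X_s(ℂ); ℚ)`
of every fibre that is a smooth projective surface: `tr(σ_s^* x ∪ σ_s^* y) = tr(x ∪ y)` (for the registered
deck pair: `τ⁴ = 𝟙` and `j⁴ = (τ²)² = 𝟙`). [cite: HatcherAT2002, §3.3 Thm. 3.26 and §3.2 Prop. 3.10]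
[cite: Fulton1998, Lemma 19.1.2 and §10.1] -/
theorem tr_cup_pull_fiberOverEnd_of_comp_four {σ : 𝒳 ⟶ 𝒳} (hσ : σ ≫ π = π) (h4 : σ ≫ σ ≫ σ ≫ σ = 𝟙 𝒳)
    (s : ComplexPoints S) (hXs : IsSmoothProjective 2 (fiberOver π s)) (x y : bettiCohomology (fiberOver π s) 2) :
    tr hXs (2 + 2) (cup (fiberOver π s) 2 2 (pull (fiberOverEnd π σ hσ s) 2 x) (pull (fiberOverEnd π σ hσ s) 2 y)) =
      tr hXs (2 + 2) (cup (fiberOver π s) 2 2 x y) := by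
  obtain ⟨h₁, h₂⟩ := fiberOverEnd_comp_cube_eq_id π hσ h4 s
  exact tr_cup_pull_pull_of_comp_eq_id hXs h₁ h₂ 2 2 x y

/-- The same for the second deck map `j` with `j ≫ j = τ ≫ τ` and `τ⁴ = 𝟙` (so `j⁴ = 𝟙`).
[cite: HatcherAT2002, §3.3 Thm. 3.26 and §3.2 Prop. 3.10] [cite: Fulton1998, Lemma 19.1.2 and §10.1] -/
theorem tr_cup_pull_fiberOverEnd_of_sq_eq {τ j : 𝒳 ⟶ 𝒳} (hjπ : j ≫ π = π)
    (h4 : τ ≫ τ ≫ τ ≫ τ = 𝟙 𝒳) (hj2 : j ≫ j = τ ≫ τ)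
    (s : ComplexPoints S) (hXs : IsSmoothProjective 2 (fiberOver π s)) (x y : bettiCohomology (fiberOver π s) 2) :
    tr hXs (2 + 2) (cup (fiberOver π s) 2 2 (pull (fiberOverEnd π j hjπ s) 2 x) (pull (fiberOverEnd π j hjπ s) 2 y)) =
      tr hXs (2 + 2) (cup (fiberOver π s) 2 2 x y) := by
  have hj4 : j ≫ j ≫ j ≫ j = 𝟙 𝒳 := by
    calc j ≫ j ≫ j ≫ j = (j ≫ j) ≫ (j ≫ j) := by simp only [Category.assoc]
      _ = (τ ≫ τ) ≫ (τ ≫ τ) := by rw [hj2]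
      _ = τ ≫ τ ≫ τ ≫ τ := by simp only [Category.assoc]
      _ = 𝟙 𝒳 := h4
  exact tr_cup_pull_fiberOverEnd_of_comp_four π hjπ hj4 s hXs x y

end Family

end Summit.HodgeConjecture.HodgeConjecture.Theorems.Q8SymplecticPowersTracePairingBridge

end
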